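import Literature.Barriers.PneNP.MatchingPolytopeExtensionComplexity
import Literature.Barriers.PneNP.MatchingSlackPsdRankSmall
import Literature.Combinatorics.Optimization.BlockPsdLiftFactorization
import HarnessLib

/-!
# `P_PM(K_n)` is a face of `P_PM(K_{n'})` for even `n ≤ n'`: `xc(P_PM(n)) ≤ xc(P_PM(n'))`
# (Rothvoß 2017, §2, footnote), also for psd lifts

T. Rothvoß, *The matching polytope has exponential extension complexity*, J. ACM 64 (2017) =
arXiv:1311.2369 [Rothvoss2017], §2 (PDF p. 6, L59–62 with its footnote; from §2 on `P_M` denotes the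
PERFECT matching polytope, cf. PDF p. 7, L7–9 "the perfect matching polytope satisfies `xc(P_M) ≥ …`"),
verbatim:

> "We consider only complete graphs `G = (V,E)` that have `|V| = n = 3m(k−3) + 2k` many vertices, for
> some odd integer `m` [Footnote: In other words, we show a lower bound only on `xc(P_M(n))` for certain
> `n`. But note that `P_M(n)` is a face of `P_M(n')` for `n ≤ n'` and hence `xc(P_M(n)) ≤ xc(P_M(n'))`.
> Thus the lower bound on the extension complexity indeed holds for every even `n`.]"

This file PROVES the footnote (no named facts), for `n' = n + k` with `k` even: fix a perfect matching
`M₀` of the `k` new vertices; the face `F = {x ∈ P_PM(K_{n+k}) | x_e = 1 (e ∈ M₀)}` — written as ONE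
affine section `Σ_{e ∈ M₀} x_e = |M₀|`, which is the same set on `P_PM` because `x_e ≤ 1` there —
projects onto `P_PM(K_n)` under restriction to the edges among the first `n` vertices:

* `image_pmFace` — `π_{E(K_n)}(F) = P_PM(K_n)` (`⊆`: on `F` every non-`M₀` edge at a new vertex
  carries `x_e = 0` by the degree equation, so the restriction keeps Edmonds' constraints and has total
  mass `n/2` — the tree's `P_PM = P_M ∩ {Σ x = n/2}`, `pmPolytope_eq_edmondsPolytope_inter`; `⊇`: a
  perfect matching `N` of `K_n` extends to the perfect matching `N ∪ M₀` of `K_{n+k}`);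
* **`hasEFOfSize_pmPolytope_of_add`** / **`hasEFOfSize_pmPolytope_mono`** — `xc(P_PM(K_n)) ≤
  xc(P_PM(K_{n'}))` for `n ≤ n'` both even, in the `HasEFOfSize` currency (affine sections and
  projections are free: `HasEFOfSize.inter_eqs`, `HasEFOfSize.image_linearMap`);
* the SEMIDEFINITE twins **`hasPsdLift_pmPolytope_of_add`** / **`hasPsdLift_pmPolytope_mono`**
  (`HasPsdLift.inter_setOf_apply_eq`, `HasPsdLift.image`);
* `pmPolytope_lowerBound_mono` / `pmPolytope_psdLowerBound_mono` — "thus the lower bound indeed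
  holds for every even `n`": a lower bound on the size of EFs (psd lifts) of `P_PM(K_n)` is one for
  `P_PM(K_{n'})`, `n ≤ n'` even.

* the SLACK-MATRIX reading (§2 works with the slack matrix `S_{UM} = |δ(U) ∩ M| − 1` of the odd-set
  inequalities, PDF pp. 5–7): `S_n` is the submatrix of `S_{n+k}` on the rows `U ⊆ {old vertices}` and
  the columns `N ∪ M₀` (`pmOddCutSlack_extend`), so psd rank and nonnegative rank of the tree's
  `pmOddCutSlack n` are monotone in even `n` (`hasPsdFactorization_pmOddCutSlack_mono`,
  `hasNonnegFactorization_pmOddCutSlack_mono`; submatrices: FGPRT [FawziEtAl2015] Ex. 5.1), and every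
  certified small case of `MatchingSlackPsdRankSmall.lean` propagates upward, e.g.
  `thirtyfive_le_of_hasPsdFactorization_of_sixteen_le`: `rk_psd(S_n) ≥ 35` for all even `n ≥ 16`.

* BLOCK lifts (Fawzi–Parrilo's `(S^b_+)^m`-lifts, the tree's `HasBlockPsdLift`; `b = 1`: LP lifts,
  `b = 2`: second-order-cone lifts): `hasBlockPsdLift_pmPolytope_of_add` / `hasBlockPsdLift_pmPolytope_mono`
  — an `(S^b_+)^m`-lift of `P_PM(K_{n'})` yields one of `P_PM(K_n)`, `n ≤ n'` both even (the face as an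
  affine section, `HasBlockPsdLift.inter_affineSubspace`, then `HasBlockPsdLift.image`).  RELATED TREE
  RESULT (factorization side, landed earlier and independently): `HasBlockPsdFactorization.of_le`
  (`BlockPsdFactorization.lean` §4) is the same face monotonicity for block psd FACTORIZATIONS of the
  odd-cut slack matrix; with `hasBlockPsdFactorization_one_iff` it also yields this file's
  `hasPsdFactorization_pmOddCutSlack_mono` — the two proofs are independent (there: lifting matchings
  inside the factorization; here: the explicit submatrix identity `pmOddCutSlack_extend`).

(The parity hypothesis is necessary: for odd `n'` the polytope `P_PM(K_{n'})` is empty.)  Companions: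
`MatchingPolytopeExtensionComplexity.lean` (`xc(P_PM(n)) ≤ xc(P_M(n))`, monotonicity of `xc(P_M(K_n))`)
and `MatchingPolytopeProjection.lean` (`xc(P_M(n)) ≤ xc(P_PM(2n))`).

WHAT THIS IS NOT: no bound on any extension complexity beyond these comparisons; nothing on P versus NP.

## References

* [Rothvoss2017] T. Rothvoß, *The matching polytope has exponential extension complexity*, J. ACM 64
  (2017) Art. 41, doi:10.1145/3127497, arXiv:1311.2369 — §2 (PDF p. 6, footnote at L61–62).
* [Edmonds1965] J. Edmonds, *Maximum matching and a polyhedron with 0,1-vertices*, J. Res. Nat. Bur.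
  Standards 69B (1965) 125–130 — §2 (tree: `EdmondsMatchingPolytope.lean`,
  `PMPolytopeEdmondsDescription.lean`).
* [FawziEtAl2015] H. Fawzi, J. Gouveia, P. A. Parrilo, R. Z. Robinson, R. R. Thomas, *Positive
  semidefinite rank*, Math. Program. 153 (2015) 133–177, arXiv:1407.4095 — Ex. 5.1 (p14, submatrix
  step; tree: `HasPsdFactorization.submatrix`).
-/

noncomputable section

open Finset Matrix

namespace Literature.Barriers.PneNP

open Literature.Combinatorics.Optimization Literature.Combinatorics.Optimization.StephenTuncel1999
open Literature.Combinatorics.SimpleGraph.CycleSpace (Crosses crosses_mk)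

variable {n k : ℕ}

/-! ### The two blocks of vertices of `K_{n+k}` -/

/-- The old vertex `i < n` of `K_{n+k}`. [cite: Rothvoss2017, §2 footnote (PDF p. 6)] -/
private def old (i : Fin n) : Fin (n + k) := Fin.castAdd k i

/-- The new vertex `n + j` of `K_{n+k}`. [cite: Rothvoss2017, §2 footnote (PDF p. 6)] -/
private def new (j : Fin k) : Fin (n + k) := Fin.natAdd n j

/-- The value of the old vertex `i` is `i`. [folklore] -/
private theorem coe_old (i : Fin n) : (old (k := k) i : ℕ) = i := Fin.val_castAdd k i

/-- The value of the new vertex `j` is `n + j`. [folklore] -/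
private theorem coe_new (j : Fin k) : (new (n := n) j : ℕ) = n + j := Fin.val_natAdd n j

/-- `old` is injective. [folklore] -/
private theorem old_injective : Function.Injective (old (n := n) (k := k)) :=
  fun i j h => Fin.ext (by have := congrArg Fin.val h; rwa [coe_old, coe_old] at this)

/-- `new` is injective. [folklore] -/
private theorem new_injective : Function.Injective (new (n := n) (k := k)) :=
  fun i j h => Fin.ext (by have := congrArg Fin.val h; rw [coe_new, coe_new] at this; omega)

/-- Old and new vertices differ. [folklore] -/
private theorem old_ne_new (i : Fin n) (j : Fin k) : old i ≠ new j := by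
  intro h
  have := congrArg Fin.val h
  rw [coe_old, coe_new] at this
  have := i.2
  omega

/-- A vertex with value `< n` is old. [folklore] -/
private theorem exists_old_of_lt {v : Fin (n + k)} (hv : (v : ℕ) < n) : ∃ i, old i = v :=
  ⟨⟨v, hv⟩, Fin.ext (by rw [coe_old])⟩

/-- A vertex with value `≥ n` is new. [folklore] -/
private theorem exists_new_of_le {v : Fin (n + k)} (hv : n ≤ (v : ℕ)) : ∃ j, new j = v :=
  ⟨⟨v - n, by have := v.2; omega⟩, Fin.ext (by rw [coe_new]; simp only; omega)⟩

/-- Every vertex is old or new. [folklore] -/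
private theorem old_or_new (v : Fin (n + k)) : (∃ i, old i = v) ∨ ∃ j, new j = v := by
  by_cases hv : (v : ℕ) < n
  · exact Or.inl (exists_old_of_lt hv)
  · exact Or.inr (exists_new_of_le (not_lt.1 hv))

/-- The set of new vertices. [cite: Rothvoss2017, §2 footnote (PDF p. 6)] -/
private def newBlock (n k : ℕ) : Finset (Fin (n + k)) := univ.image new

/-- The set of old vertices. [cite: Rothvoss2017, §2 footnote (PDF p. 6)] -/
private def oldBlock (n k : ℕ) : Finset (Fin (n + k)) := univ.image old

/-- The two blocks are disjoint. [folklore] -/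
private theorem disjoint_oldBlock_newBlock : Disjoint (oldBlock n k) (newBlock n k) := by
  rw [Finset.disjoint_left]
  intro v hv hv'
  unfold oldBlock at hv
  unfold newBlock at hv'
  rw [Finset.mem_image] at hv hv'
  obtain ⟨i, -, rfl⟩ := hv
  obtain ⟨j, -, hj⟩ := hv'
  exact old_ne_new i j hj.symm

/-- The two blocks cover all vertices. [folklore] -/
private theorem oldBlock_union_newBlock : oldBlock n k ∪ newBlock n k = univ := by
  apply Finset.eq_univ_of_forall
  intro v
  rcases old_or_new v with ⟨i, rfl⟩ | ⟨j, rfl⟩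
  · exact Finset.mem_union_left _ (Finset.mem_image_of_mem _ (Finset.mem_univ i))
  · exact Finset.mem_union_right _ (Finset.mem_image_of_mem _ (Finset.mem_univ j))

/-- The new block has `k` vertices. [folklore] -/
private theorem card_newBlock : (newBlock n k).card = k := by
  unfold newBlock
  rw [Finset.card_image_of_injective _ new_injective, Finset.card_univ, Fintype.card_fin]

/-! ### The edge embedding `E(K_n) ↪ E(K_{n+k})` and the restriction map -/

/-- The edge `{i, i'}` of `K_n` as the edge `{i, i'}` of `K_{n+k}` (the tree's `mapEdgeEquiv` along
`Fin.castAddEmb` followed by the inclusion `edgeIncl` of the edges of the copy of `K_n`).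
[cite: Rothvoss2017, §2 footnote (PDF p. 6)] -/
def embedEdge (n k : ℕ) (e : EKn n) : EKn (n + k) :=
  edgeIncl (le_top (a := (⊤ : SimpleGraph (Fin n)).map (Fin.castAddEmb k)))
    (mapEdgeEquiv (G := (⊤ : SimpleGraph (Fin n))) (Fin.castAddEmb k) e)

/-- The underlying pair of the embedded edge. [cite: Rothvoss2017, §2 footnote (PDF p. 6)] -/
theorem coe_embedEdge (e : EKn n) :
    ((embedEdge n k e : EKn (n + k)) : Sym2 (Fin (n + k))) =
      Sym2.map (Fin.castAdd k) (e : Sym2 (Fin n)) :=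
  rfl

/-- `embedEdge` is injective. [folklore] -/
private theorem embedEdge_injective : Function.Injective (embedEdge n k) := by
  intro e e' h
  have h1 := congrArg (fun f : EKn (n + k) => (f : Sym2 (Fin (n + k)))) h
  simp only [coe_embedEdge] at h1
  exact Subtype.ext (Sym2.map.injective old_injective h1)

/-- An edge of `K_{n+k}` with both ends old is an embedded edge. [folklore] -/
private theorem exists_embedEdge_of_forall_old {f : EKn (n + k)}
    (hf : ∀ v ∈ (f : Sym2 (Fin (n + k))), ∃ i, old i = v) : ∃ e, embedEdge n k e = f := by
  obtain ⟨f, hfE⟩ := f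
  induction f using Sym2.ind with
  | h a b =>
    obtain ⟨i, rfl⟩ := hf a (Sym2.mem_mk_left a b)
    obtain ⟨i', rfl⟩ := hf _ (Sym2.mem_mk_right _ b)
    have hne : i ≠ i' := by
      intro h
      rw [SimpleGraph.mem_edgeSet, h] at hfE
      exact hfE rfl
    refine ⟨⟨s(i, i'), by rw [SimpleGraph.mem_edgeSet]; exact hne⟩, Subtype.ext ?_⟩
    rw [coe_embedEdge]
    rfl

/-- **Restriction to the edges among the old vertices**, `x ↦ (x_{ {i,i'} })_{i,i' < n}`, a linear map
`ℝ^{E(K_{n+k})} → ℝ^{E(K_n)}`. [cite: Rothvoss2017, §2 footnote (PDF p. 6)] -/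
def restrictOld (n k : ℕ) : (EKn (n + k) → ℝ) →ₗ[ℝ] (EKn n → ℝ) :=
  LinearMap.funLeft ℝ ℝ (embedEdge n k)

/-- `restrictOld` evaluates at the embedded edge. [cite: Rothvoss2017, §2 footnote (PDF p. 6)] -/
@[simp] theorem restrictOld_apply (x : EKn (n + k) → ℝ) (e : EKn n) :
    restrictOld n k x e = x (embedEdge n k e) :=
  rfl

/-! ### The face `F_{M₀} = {x ∈ P_PM(K_{n+k}) | x_e = 1, e ∈ M₀}` as one affine section -/

/-- The edges of `K_{n+k}` lying in the edge set `M₀`. [cite: Rothvoss2017, §2 footnote (PDF p. 6)] -/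
def pmEdgeSet (M₀ : Finset (Sym2 (Fin (n + k)))) : Finset (EKn (n + k)) :=
  univ.filter fun e => (e : Sym2 (Fin (n + k))) ∈ M₀

/-- Membership in `pmEdgeSet`. [cite: Rothvoss2017, §2 footnote (PDF p. 6)] -/
@[simp] theorem mem_pmEdgeSet {M₀ : Finset (Sym2 (Fin (n + k)))} {e : EKn (n + k)} :
    e ∈ pmEdgeSet M₀ ↔ (e : Sym2 (Fin (n + k))) ∈ M₀ := by
  unfold pmEdgeSet
  simp

/-- **The mass on `M₀`**, the linear functional `x ↦ Σ_{e ∈ M₀} x_e`.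
[cite: Rothvoss2017, §2 footnote (PDF p. 6)] -/
def pmEdgeMass (M₀ : Finset (Sym2 (Fin (n + k)))) : (EKn (n + k) → ℝ) →ₗ[ℝ] ℝ where
  toFun x := ∑ e ∈ pmEdgeSet M₀, x e
  map_add' x y := by simp only [Pi.add_apply, Finset.sum_add_distrib]
  map_smul' c x := by simp only [Pi.smul_apply, smul_eq_mul, RingHom.id_apply, Finset.mul_sum]

/-- `pmEdgeMass` unfolds to the sum. [cite: Rothvoss2017, §2 footnote (PDF p. 6)] -/
theorem pmEdgeMass_apply (M₀ : Finset (Sym2 (Fin (n + k)))) (x : EKn (n + k) → ℝ) :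
    pmEdgeMass M₀ x = ∑ e ∈ pmEdgeSet M₀, x e :=
  rfl

/-- **The face `F_{M₀}` of `P_PM(K_{n+k})`** on which the edges of `M₀` carry `x_e = 1`, written as the
single affine section `Σ_{e ∈ M₀} x_e = |M₀|` (the same set, `eq_one_of_mem_pmFace`).
[cite: Rothvoss2017, §2 footnote (PDF p. 6: "P_M(n) is a face of P_M(n')")] -/
def pmFace (M₀ : Finset (Sym2 (Fin (n + k)))) : Set (EKn (n + k) → ℝ) :=
  pmPolytope (n + k) ∩ {x | pmEdgeMass M₀ x = ((pmEdgeSet M₀).card : ℝ)}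

/-- A coordinate of a point of `P_PM` is at most `1` (it is a term of a degree equation).
[cite: Edmonds1965, §2 (p. 126), perfect-matching form] -/
theorem apply_le_one_of_mem_pmPolytope {N : ℕ} {x : EKn N → ℝ} (hx : x ∈ pmPolytope N) (e : EKn N) :
    x e ≤ 1 := by
  classical
  obtain ⟨f, hf⟩ := e
  induction f using Sym2.ind with
  | h a b =>
    have h1 := sum_incident_eq_one_of_mem_pmPolytope hx a
    rw [← h1]
    exact Finset.single_le_sum (f := x) (fun e _ => pmPolytope_nonneg x hx e)
      (Finset.mem_filter.2 ⟨Finset.mem_univ _, Sym2.mem_mk_left a b⟩)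

/-- On the face, every edge of `M₀` carries `x_e = 1`. [cite: Rothvoss2017, §2 footnote (PDF p. 6)] -/
theorem eq_one_of_mem_pmFace {M₀ : Finset (Sym2 (Fin (n + k)))} {x : EKn (n + k) → ℝ}
    (hx : x ∈ pmFace M₀) {e : EKn (n + k)} (he : e ∈ pmEdgeSet M₀) : x e = 1 := by
  have hle : ∀ e ∈ pmEdgeSet M₀, x e ≤ 1 := fun e _ => apply_le_one_of_mem_pmPolytope hx.1 e
  have hsum : ∑ e ∈ pmEdgeSet M₀, x e = ∑ e ∈ pmEdgeSet M₀, (1 : ℝ) := by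
    rw [Finset.sum_const, nsmul_eq_mul, mul_one]
    exact hx.2
  exact (Finset.sum_eq_sum_iff_of_le hle).1 hsum e he

/-- Conversely, a point of `P_PM` with `x_e = 1` on `M₀` lies on the face.
[cite: Rothvoss2017, §2 footnote (PDF p. 6)] -/
theorem mem_pmFace_of_forall_eq_one {M₀ : Finset (Sym2 (Fin (n + k)))} {x : EKn (n + k) → ℝ}
    (hx : x ∈ pmPolytope (n + k)) (h1 : ∀ e ∈ pmEdgeSet M₀, x e = 1) :
    x ∈ pmFace M₀ := by
  refine ⟨hx, ?_⟩
  show pmEdgeMass M₀ x = _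
  rw [pmEdgeMass_apply, Finset.sum_congr rfl h1, Finset.sum_const, nsmul_eq_mul, mul_one]

section Face

variable {M₀ : Finset (Sym2 (Fin (n + k)))}

/-- **On the face, a non-`M₀` edge at a new vertex carries `x_e = 0`** (the degree equation at the
new vertex is already saturated by its `M₀`-edge). [cite: Rothvoss2017, §2 footnote (PDF p. 6)] -/
theorem apply_eq_zero_of_mem_pmFace (hM₀ : IsPMOn (univ.image (Fin.natAdd n)) M₀)
    {x : EKn (n + k) → ℝ} (hx : x ∈ pmFace M₀) {f : EKn (n + k)}
    (hf : (f : Sym2 (Fin (n + k))) ∉ M₀) {j : Fin k}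
    (hj : Fin.natAdd n j ∈ (f : Sym2 (Fin (n + k)))) :
    x f = 0 := by
  classical
  -- the `M₀`-edge `g` at the new vertex `n + j`
  obtain ⟨g, hgM, hjg⟩ := hM₀.exists_mem (Finset.mem_image_of_mem _ (Finset.mem_univ j))
  have hgE : g ∈ (⊤ : SimpleGraph (Fin (n + k))).edgeSet := hM₀.mem_edgeSet_top hgM
  set g' : EKn (n + k) := ⟨g, hgE⟩ with hg'
  have hg1 : x g' = 1 := eq_one_of_mem_pmFace hx (mem_pmEdgeSet.2 hgM)
  have hne : g' ≠ f := by
    intro h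
    rw [← h] at hf
    exact hf hgM
  -- both lie in the star of `n + j`, whose total is `1`
  have hdeg := sum_incident_eq_one_of_mem_pmPolytope hx.1 (Fin.natAdd n j)
  have hsub : ({g', f} : Finset (EKn (n + k))) ⊆
      univ.filter (fun e : EKn (n + k) => Fin.natAdd n j ∈ (e : Sym2 (Fin (n + k)))) := by
    intro e he
    rw [Finset.mem_insert, Finset.mem_singleton] at he
    rw [Finset.mem_filter]
    rcases he with rfl | rfl
    · exact ⟨Finset.mem_univ _, hjg⟩
    · exact ⟨Finset.mem_univ _, hj⟩
  have hle := Finset.sum_le_sum_of_subset_of_nonneg hsub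
    (fun e _ _ => pmPolytope_nonneg x hx.1 e)
  rw [Finset.sum_pair hne, hdeg, hg1] at hle
  have h0 := pmPolytope_nonneg x hx.1 f
  linarith

/-- The edges of `M₀` are edges of the new block: their vertices are new.
[cite: Rothvoss2017, §2 footnote (PDF p. 6)] -/
private theorem exists_new_of_mem (hM₀ : IsPMOn (univ.image (Fin.natAdd n)) M₀)
    {g : Sym2 (Fin (n + k))} (hg : g ∈ M₀) {v : Fin (n + k)} (hv : v ∈ g) :
    ∃ j, new j = v := by
  have h := hM₀.mem_of_mem hg hv
  rw [Finset.mem_image] at h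
  obtain ⟨j, -, rfl⟩ := h
  exact ⟨j, rfl⟩

/-- `|pmEdgeSet M₀| = |M₀|` (every edge of a perfect matching is an edge of the complete graph).
[folklore] -/
private theorem card_pmEdgeSet (hM₀ : IsPMOn (univ.image (Fin.natAdd n)) M₀) :
    (pmEdgeSet M₀).card = M₀.card := by
  classical
  rw [← Finset.card_map (Function.Embedding.subtype _)]
  congr 1
  ext g
  rw [Finset.mem_map]
  constructor
  · rintro ⟨e, he, rfl⟩
    exact mem_pmEdgeSet.1 he
  · intro hg
    exact ⟨⟨g, hM₀.mem_edgeSet_top hg⟩, mem_pmEdgeSet.2 hg, rfl⟩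

/-- `2 |M₀| = k`. [folklore] -/
private theorem two_mul_card_pmEdgeSet (hM₀ : IsPMOn (univ.image (Fin.natAdd n)) M₀) :
    2 * ((pmEdgeSet M₀).card : ℝ) = k := by
  have h := hM₀.two_mul_card
  rw [show (univ.image (Fin.natAdd n) : Finset (Fin (n + k))) = newBlock n k from rfl,
    card_newBlock] at h
  rw [card_pmEdgeSet hM₀]
  exact_mod_cast h

/-- **The restriction of a point of the face has total mass `n/2`**: of the total `(n+k)/2`, the
`M₀`-edges carry `k/2` and the other edges at new vertices carry `0`.
[cite: Rothvoss2017, §2 footnote (PDF p. 6)] -/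
theorem sum_restrictOld_of_mem_pmFace (hM₀ : IsPMOn (univ.image (Fin.natAdd n)) M₀)
    {x : EKn (n + k) → ℝ} (hx : x ∈ pmFace M₀) :
    ∑ e, restrictOld n k x e = (n : ℝ) / 2 := by
  classical
  have htot : ∑ f, x f = ((n + k : ℕ) : ℝ) / 2 := by
    have h := hx.1
    rw [pmPolytope_eq_edmondsPolytope_inter] at h
    exact h.2
  -- split the edges of `K_{n+k}` into embedded edges and the rest
  set A : Finset (EKn (n + k)) := univ.map ⟨embedEdge n k, embedEdge_injective⟩ with hA
  have hsplit := Finset.sum_add_sum_compl A x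
  have hAsum : ∑ f ∈ A, x f = ∑ e, restrictOld n k x e := by
    rw [hA, Finset.sum_map]
    rfl
  -- on the complement: `M₀`-edges carry `1`, the others `0`
  have hcompl : ∑ f ∈ Aᶜ, x f = ((pmEdgeSet M₀).card : ℝ) := by
    have hsub : pmEdgeSet M₀ ⊆ Aᶜ := by
      intro g hg
      rw [Finset.mem_compl]
      intro hgA
      rw [hA, Finset.mem_map] at hgA
      obtain ⟨e, -, rfl⟩ := hgA
      -- an embedded edge has old vertices, an `M₀`-edge has new ones
      obtain ⟨e₀, he₀⟩ := e
      induction e₀ using Sym2.ind with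
      | h a b =>
        have hg' := mem_pmEdgeSet.1 hg
        have hmem :
            old a ∈ ((embedEdge n k ⟨s(a, b), he₀⟩ : EKn (n + k)) : Sym2 (Fin (n + k))) := by
          rw [coe_embedEdge, Sym2.map_mk]
          exact Sym2.mem_mk_left _ _
        obtain ⟨j, hj⟩ := exists_new_of_mem hM₀ hg' hmem
        exact old_ne_new a j hj.symm
    rw [← Finset.sum_sdiff hsub]
    have h1 : ∑ g ∈ pmEdgeSet M₀, x g = ((pmEdgeSet M₀).card : ℝ) := by
      rw [Finset.sum_congr rfl fun g hg => eq_one_of_mem_pmFace hx hg, Finset.sum_const,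
        nsmul_eq_mul, mul_one]
    have h0 : ∑ g ∈ Aᶜ \ pmEdgeSet M₀, x g = 0 := by
      refine Finset.sum_eq_zero fun g hg => ?_
      rw [Finset.mem_sdiff, Finset.mem_compl] at hg
      have hgM : (g : Sym2 (Fin (n + k))) ∉ M₀ := fun h => hg.2 (mem_pmEdgeSet.2 h)
      -- `g` is not embedded, so it has a new vertex
      have hnew : ∃ v ∈ (g : Sym2 (Fin (n + k))), ∃ j, new j = v := by
        by_contra hcon
        have hold : ∀ v ∈ (g : Sym2 (Fin (n + k))), ∃ i, old i = v := fun v hv =>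
          (old_or_new v).resolve_right fun ⟨j, hj⟩ => hcon ⟨v, hv, j, hj⟩
        obtain ⟨e, he⟩ := exists_embedEdge_of_forall_old hold
        exact hg.1 (by rw [hA, Finset.mem_map]; exact ⟨e, Finset.mem_univ _, he⟩)
      obtain ⟨v, hv, j, rfl⟩ := hnew
      exact apply_eq_zero_of_mem_pmFace hM₀ hx hgM hv
    rw [h1, h0, zero_add]
  rw [hAsum, hcompl] at hsplit
  have hk := two_mul_card_pmEdgeSet hM₀
  rw [← hsplit] at htot
  push_cast at htot
  linarith

/-- **`N ∪ M₀` is a perfect matching of `K_{n+k}`** for a perfect matching `N` of `K_n` (copied onto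
the old vertices) and the fixed perfect matching `M₀` of the new ones.
[cite: Rothvoss2017, §2 footnote (PDF p. 6)] -/
theorem isPMOn_extend (hM₀ : IsPMOn (univ.image (Fin.natAdd n)) M₀) {N : Finset (Sym2 (Fin n))}
    (hN : IsPMOn univ N) : IsPMOn univ (N.image (Sym2.map (Fin.castAdd k)) ∪ M₀) := by
  classical
  have hN' : IsPMOn (oldBlock n k) (N.image (Sym2.map old)) :=
    hN.image old (old_injective.injOn)
  have h := hN'.union hM₀ (by
    rw [show (univ.image (Fin.natAdd n) : Finset (Fin (n + k))) = newBlock n k from rfl]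
    exact disjoint_oldBlock_newBlock)
  rwa [show (univ.image (Fin.natAdd n) : Finset (Fin (n + k))) = newBlock n k from rfl,
    oldBlock_union_newBlock] at h

/-- **Extension of a perfect matching of `K_n` by `M₀`**: for a perfect matching `N` of the old
vertices, `N ∪ M₀` is a perfect matching of `K_{n+k}` lying on the face and restricting to `N`.
[cite: Rothvoss2017, §2 footnote (PDF p. 6)] -/
theorem charVec_mem_image_pmFace (hM₀ : IsPMOn (univ.image (Fin.natAdd n)) M₀)
    {N : Finset (Sym2 (Fin n))} (hN : IsPMOn univ N) :
    charVec N ∈ restrictOld n k '' pmFace M₀ := by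
  classical
  set M : Finset (Sym2 (Fin (n + k))) := N.image (Sym2.map old) ∪ M₀ with hM
  have hPM : IsPMOn univ M := isPMOn_extend hM₀ hN
  refine ⟨charVec M,
    mem_pmFace_of_forall_eq_one (charVec_mem_pmPolytope hPM) fun e he => ?_, ?_⟩
  · show (if (e : Sym2 (Fin (n + k))) ∈ M then (1 : ℝ) else 0) = 1
    rw [if_pos (Finset.mem_union_right _ (mem_pmEdgeSet.1 he))]
  · funext e
    rw [restrictOld_apply]
    show (if ((embedEdge n k e : EKn (n + k)) : Sym2 (Fin (n + k))) ∈ M then (1 : ℝ) else 0) =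
      if (e : Sym2 (Fin n)) ∈ N then (1 : ℝ) else 0
    rw [coe_embedEdge]
    congr 1
    apply propext
    rw [hM, Finset.mem_union, Finset.mem_image]
    constructor
    · rintro (⟨e₀, he₀, h⟩ | h)
      · rwa [← Sym2.map.injective old_injective h]
      · exfalso
        obtain ⟨e₁, he₁⟩ := e
        induction e₁ using Sym2.ind with
        | h a b =>
          obtain ⟨j, hj⟩ := exists_new_of_mem hM₀ h
            (by rw [Sym2.map_mk]; exact Sym2.mem_mk_left _ _)
          exact old_ne_new a j hj.symm
    · intro he
      exact Or.inl ⟨_, he, rfl⟩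

variable [DecidableRel ((⊤ : SimpleGraph (Fin n)).map (Fin.castAddEmb k)).Adj]

/-- **The restriction of a point of the face lies in `P_PM(K_n)`**: it satisfies Edmonds' matching
constraints (restriction to a subgraph, `restrictEdges_mem_edmondsPolytope`, transported along the
copy of `K_n`, `mem_edmondsPolytope_map_iff`) and has total mass `n/2`
(`sum_restrictOld_of_mem_pmFace`), and `P_PM = P_M ∩ {Σ x = n/2}` (`pmPolytope_eq_edmondsPolytope_inter`).
[cite: Rothvoss2017, §2 footnote (PDF p. 6)] -/
theorem restrictOld_mem_pmPolytope (hM₀ : IsPMOn (univ.image (Fin.natAdd n)) M₀)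
    {x : EKn (n + k) → ℝ} (hx : x ∈ pmFace M₀) : restrictOld n k x ∈ pmPolytope n := by
  rw [pmPolytope_eq_edmondsPolytope_inter]
  refine ⟨?_, sum_restrictOld_of_mem_pmFace hM₀ hx⟩
  have h1 : x ∈ edmondsPolytope (⊤ : SimpleGraph (Fin (n + k))) := by
    have h := hx.1
    rw [pmPolytope_eq_edmondsPolytope_inter] at h
    exact h.1
  have h2 := restrictEdges_mem_edmondsPolytope
    (le_top (a := (⊤ : SimpleGraph (Fin n)).map (Fin.castAddEmb k))) h1
  exact (mem_edmondsPolytope_map_iff (G := (⊤ : SimpleGraph (Fin n))) (Fin.castAddEmb k) _).1 h2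

/-- **`π_{E(K_n)}(F_{M₀}) = P_PM(K_n)`**: the face of `P_PM(K_{n+k})` fixing the perfect matching `M₀`
of the new vertices projects onto the perfect matching polytope of the old ones.
[cite: Rothvoss2017, §2 footnote (PDF p. 6: "P_M(n) is a face of P_M(n')")] -/
theorem image_pmFace (hM₀ : IsPMOn (univ.image (Fin.natAdd n)) M₀) :
    restrictOld n k '' pmFace M₀ = pmPolytope n := by
  classical
  apply Set.Subset.antisymm
  · rintro _ ⟨x, hx, rfl⟩
    exact restrictOld_mem_pmPolytope hM₀ hx
  · have hconv : Convex ℝ (restrictOld n k '' pmFace M₀) := by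
      refine Convex.linear_image (Convex.inter (convex_convexHull ℝ _) ?_) _
      have h :=
        (convex_singleton (𝕜 := ℝ) ((pmEdgeSet M₀).card : ℝ)).linear_preimage (pmEdgeMass M₀)
      exact h
    exact convexHull_min (by rintro _ ⟨N, hN, rfl⟩; exact charVec_mem_image_pmFace hM₀ hN)
      hconv

end Face

/-! ### Consequences: monotonicity of `xc(P_PM(K_n))` and of the psd rank in even `n` -/

/-- A perfect matching of the new block exists when `k` is even. [folklore] -/
private theorem exists_isPMOn_newBlock (hk : Even k) :
    ∃ M₀ : Finset (Sym2 (Fin (n + k))), IsPMOn (univ.image (Fin.natAdd n)) M₀ := by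
  classical
  obtain ⟨M₁, hM₁⟩ := exists_isPMOn_of_even k (univ : Finset (Fin k)) (by simp) hk
  exact ⟨_, hM₁.image (Fin.natAdd n) (new_injective.injOn)⟩

/-- **`xc(P_PM(K_n)) ≤ xc(P_PM(K_{n+k}))` for even `k`**: an extended formulation of `P_PM(K_{n+k})`
of size `r` yields one of `P_PM(K_n)` of size `r` — cut out the face `F_{M₀}` (one equation,
`HasEFOfSize.inter_eqs`) and project (`HasEFOfSize.image_linearMap`).
[cite: Rothvoss2017, §2 footnote (PDF p. 6)] -/
theorem hasEFOfSize_pmPolytope_of_add (hk : Even k) {r : ℕ} (h : HasEFOfSize (pmPolytope (n + k)) r) :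
    HasEFOfSize (pmPolytope n) r := by
  classical
  obtain ⟨M₀, hM₀⟩ := exists_isPMOn_newBlock (n := n) hk
  have h1 := h.inter_eqs (T := Unit)
    (fun _ => fun e : EKn (n + k) => if e ∈ pmEdgeSet M₀ then (1 : ℝ) else 0)
    (fun _ => ((pmEdgeSet M₀).card : ℝ))
  have hset : pmPolytope (n + k) ∩ {x : EKn (n + k) → ℝ | ∀ _ : Unit,
      (fun e : EKn (n + k) => if e ∈ pmEdgeSet M₀ then (1 : ℝ) else 0) ⬝ᵥ x =
        ((pmEdgeSet M₀).card : ℝ)} = pmFace M₀ := by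
    unfold pmFace
    congr 1
    ext x
    simp only [Set.mem_setOf_eq, forall_const, dotProduct, ite_mul, one_mul, zero_mul,
      Finset.sum_ite_mem, Finset.univ_inter, pmEdgeMass_apply]
  rw [hset] at h1
  have h2 := h1.image_linearMap (restrictOld n k)
  rwa [image_pmFace hM₀] at h2

/-- **The semidefinite twin**: a psd lift of `P_PM(K_{n+k})` of size `m` yields one of `P_PM(K_n)` of
size `m`, `k` even (affine sections and linear images are free for psd lifts:
`HasPsdLift.inter_setOf_apply_eq`, `HasPsdLift.image`). [cite: Rothvoss2017, §2 footnote (PDF p. 6) and §4.2 (PDF p. 13)] -/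
theorem hasPsdLift_pmPolytope_of_add (hk : Even k) {m : ℕ} (h : HasPsdLift (pmPolytope (n + k)) m) :
    HasPsdLift (pmPolytope n) m := by
  classical
  obtain ⟨M₀, hM₀⟩ := exists_isPMOn_newBlock (n := n) hk
  have h1 : HasPsdLift (pmFace M₀) m := h.inter_setOf_apply_eq (pmEdgeMass M₀) _
  have h2 := h1.image (restrictOld n k)
  rwa [image_pmFace hM₀] at h2

/-- **`xc(P_PM(K_n)) ≤ xc(P_PM(K_{n'}))` for `n ≤ n'` both even.**
[cite: Rothvoss2017, §2 footnote (PDF p. 6: "P_M(n) is a face of P_M(n') for n ≤ n' and hence xc(P_M(n)) ≤ xc(P_M(n'))")] -/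
theorem hasEFOfSize_pmPolytope_mono {n n' r : ℕ} (hle : n ≤ n') (hn : Even n) (hn' : Even n')
    (h : HasEFOfSize (pmPolytope n') r) : HasEFOfSize (pmPolytope n) r := by
  obtain ⟨k, rfl⟩ := Nat.exists_eq_add_of_le hle
  have hk : Even k := by
    have := (Nat.even_add.1 hn')
    exact this.1 hn
  exact hasEFOfSize_pmPolytope_of_add hk h

/-- **Psd lifts: `rank_psd(P_PM(K_n)) ≤ rank_psd(P_PM(K_{n'}))` for `n ≤ n'` both even**, in lift form.
[cite: Rothvoss2017, §2 footnote (PDF p. 6) and §4.2 (PDF p. 13)] -/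
theorem hasPsdLift_pmPolytope_mono {n n' m : ℕ} (hle : n ≤ n') (hn : Even n) (hn' : Even n')
    (h : HasPsdLift (pmPolytope n') m) : HasPsdLift (pmPolytope n) m := by
  obtain ⟨k, rfl⟩ := Nat.exists_eq_add_of_le hle
  have hk : Even k := by
    have := (Nat.even_add.1 hn')
    exact this.1 hn
  exact hasPsdLift_pmPolytope_of_add hk h

/-- **"Thus the lower bound on the extension complexity indeed holds for every even `n`"**: a lower
bound `B` on the size of every extended formulation of `P_PM(K_n)` is one for `P_PM(K_{n'})`,
`n ≤ n'` both even. [cite: Rothvoss2017, §2 footnote (PDF p. 6)] -/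
theorem pmPolytope_lowerBound_mono {n n' : ℕ} (hle : n ≤ n') (hn : Even n) (hn' : Even n')
    {B : ℝ}
    (hB : ∀ r : ℕ, HasEFOfSize (pmPolytope n) r → B ≤ r) :
    ∀ r : ℕ, HasEFOfSize (pmPolytope n') r → B ≤ r :=
  fun r hr => hB r (hasEFOfSize_pmPolytope_mono hle hn hn' hr)

/-- The same transfer for lower bounds on the size of psd lifts.
[cite: Rothvoss2017, §2 footnote (PDF p. 6) and §4.2 (PDF p. 13)] -/
theorem pmPolytope_psdLowerBound_mono {n n' : ℕ} (hle : n ≤ n') (hn : Even n) (hn' : Even n')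
    {B : ℝ} (hB : ∀ m : ℕ, HasPsdLift (pmPolytope n) m → B ≤ m) :
    ∀ m : ℕ, HasPsdLift (pmPolytope n') m → B ≤ m :=
  fun m hm => hB m (hasPsdLift_pmPolytope_mono hle hn hn' hm)

/-! ### The slack-matrix reading: `S_n` is a submatrix of `S_{n+k}`, so `rk_psd` and `rk₊` are monotone -/

section Slack

variable {M₀ : Finset (Sym2 (Fin (n + k)))}

/-- The odd set `U` of old vertices, as an odd set of `K_{n+k}` (a row of `S_{n+k}`).
[cite: Rothvoss2017, §2 (PDF pp. 5–6: the rows `U`, `|U|` odd) and footnote (PDF p. 6)] -/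
def embedOddSet (U : OddSet n) : OddSet (n + k) :=
  ⟨U.1.image (Fin.castAdd k), by
    rw [Finset.card_image_of_injective _ (show Function.Injective (Fin.castAdd k : Fin n → _) from
      old_injective)]
    exact U.2⟩

/-- The underlying set of the embedded odd set. [cite: Rothvoss2017, §2 footnote (PDF p. 6)] -/
theorem coe_embedOddSet (U : OddSet n) :
    ((embedOddSet (k := k) U : OddSet (n + k)) : Finset (Fin (n + k))) =
      U.1.image (Fin.castAdd k) :=
  rfl

/-- The perfect matching `N ∪ M₀` of `K_{n+k}` (a column of `S_{n+k}`), for a perfect matching `N` of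
`K_n` and the fixed perfect matching `M₀` of the new vertices.
[cite: Rothvoss2017, §2 (PDF pp. 5–6: the columns `M`) and footnote (PDF p. 6)] -/
def extendPMatch (hM₀ : IsPMOn (univ.image (Fin.natAdd n)) M₀) (N : PMatch n) :
    PMatch (n + k) :=
  ⟨N.1.image (Sym2.map (Fin.castAdd k)) ∪ M₀, isPMOn_extend hM₀ N.2⟩

/-- The underlying edge set of the extended matching. [cite: Rothvoss2017, §2 footnote (PDF p. 6)] -/
theorem coe_extendPMatch (hM₀ : IsPMOn (univ.image (Fin.natAdd n)) M₀) (N : PMatch n) :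
    ((extendPMatch hM₀ N : PMatch (n + k)) : Finset (Sym2 (Fin (n + k)))) =
      N.1.image (Sym2.map (Fin.castAdd k)) ∪ M₀ :=
  rfl

/-- An old pair crosses the embedded set iff the pair crosses the set. [folklore] -/
private theorem crosses_map_old_iff (U : Finset (Fin n)) (e : Sym2 (Fin n)) :
    Crosses (U.image (Fin.castAdd k)) (Sym2.map (Fin.castAdd k) e) ↔ Crosses U e := by
  induction e using Sym2.ind with
  | h a b =>
    have hmem : ∀ c : Fin n, Fin.castAdd k c ∈ U.image (Fin.castAdd k) ↔ c ∈ U :=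
        fun c => by
      rw [Finset.mem_image]
      constructor
      · rintro ⟨c', hc', h⟩
        rwa [← old_injective h]
      · exact fun hc => ⟨c, hc, rfl⟩
    rw [Sym2.map_mk, crosses_mk, crosses_mk, hmem, hmem]

/-- An edge of `M₀` does not cross a set of old vertices. [folklore] -/
private theorem not_crosses_of_mem (hM₀ : IsPMOn (univ.image (Fin.natAdd n)) M₀)
    (U : Finset (Fin n)) {g : Sym2 (Fin (n + k))} (hg : g ∈ M₀) :
    ¬Crosses (U.image (Fin.castAdd k)) g := by
  have hnotin : ∀ v ∈ g, v ∉ U.image (Fin.castAdd k) := fun v hv hvU => by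
    obtain ⟨j, rfl⟩ := exists_new_of_mem hM₀ hg hv
    rw [Finset.mem_image] at hvU
    obtain ⟨i, -, hi⟩ := hvU
    exact old_ne_new i j hi
  induction g using Sym2.ind with
  | h a b =>
    rw [crosses_mk]
    rintro (⟨ha, -⟩ | ⟨-, hb⟩)
    · exact hnotin a (Sym2.mem_mk_left a b) ha
    · exact hnotin b (Sym2.mem_mk_right a b) hb

/-- **The cut counts agree**: `|δ(U) ∩ (N ∪ M₀)| = |δ(U) ∩ N|` in `K_{n+k}` resp. `K_n` (the edges of
`M₀` join new vertices and do not cross `U`). [cite: Rothvoss2017, §2 (PDF pp. 5–6) and footnote (PDF p. 6)] -/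
theorem cc_extend (hM₀ : IsPMOn (univ.image (Fin.natAdd n)) M₀) (U : OddSet n) (N : PMatch n) :
    cc (embedOddSet U) (extendPMatch hM₀ N) = cc U N := by
  classical
  unfold cc
  rw [coe_embedOddSet, coe_extendPMatch, Finset.filter_union]
  have h0 : M₀.filter (Crosses (U.1.image (Fin.castAdd k))) = ∅ :=
    Finset.filter_eq_empty_iff.2 fun g hg => not_crosses_of_mem hM₀ U.1 hg
  rw [h0, Finset.union_empty, Finset.filter_image, Finset.card_image_of_injective _
    (Sym2.map.injective (show Function.Injective (Fin.castAdd k : Fin n → _) from old_injective))]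
  congr 1
  exact Finset.filter_congr fun e _ => crosses_map_old_iff U.1 e

/-- **`S_n` is a submatrix of `S_{n+k}`**: `S_{n+k}(U, N ∪ M₀) = S_n(U, N)`.
[cite: Rothvoss2017, §2 (PDF pp. 5–6: `S_{UM} = |δ(U) ∩ M| − 1`) and footnote (PDF p. 6)] -/
theorem pmOddCutSlack_extend (hM₀ : IsPMOn (univ.image (Fin.natAdd n)) M₀) (U : OddSet n)
    (N : PMatch n) :
    pmOddCutSlack (n + k) (embedOddSet U) (extendPMatch hM₀ N) = pmOddCutSlack n U N := by
  rw [pmOddCutSlack_apply, pmOddCutSlack_apply, cc_extend]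

/-- Submatrices of a matrix with a nonnegative factorization of size `r` have one of size `r`
(restrict the factors). [folklore] -/
private theorem hasNonnegFactorization_submatrix {ι κ ι' κ' : Type*} {S : ι → κ → ℝ}
    {r : ℕ} (h : HasNonnegFactorization S r) (f : ι' → ι) (g : κ' → κ) :
    HasNonnegFactorization (fun i j => S (f i) (g j)) r := by
  obtain ⟨A, B, hA, hB, hS⟩ := h
  exact ⟨fun i => A (f i), fun l j => B l (g j), fun i l => hA _ _, fun l j => hB _ _,
    fun i j => hS _ _⟩

/-- **`rk_psd(S_n) ≤ rk_psd(S_{n+k})` for even `k`**: a psd factorization of the odd-cut slack matrix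
of `K_{n+k}` of size `r` restricts to one of the odd-cut slack matrix of `K_n` (a submatrix,
`pmOddCutSlack_extend`; FGPRT Ex. 5.1: "`D_n` is a submatrix of … so `rank_psd(D_n) ≤ k`").
[cite: Rothvoss2017, §2 footnote (PDF p. 6)] [cite: FawziEtAl2015, Ex. 5.1 (p14, submatrix step)] -/
theorem hasPsdFactorization_pmOddCutSlack_of_add (hk : Even k) {r : ℕ}
    (h : HasPsdFactorization (pmOddCutSlack (n + k)) r) :
    HasPsdFactorization (pmOddCutSlack n) r := by
  obtain ⟨M₀, hM₀⟩ := exists_isPMOn_newBlock (n := n) hk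
  have h1 := h.submatrix (embedOddSet (k := k)) (extendPMatch hM₀)
  have hfun : (fun U N => pmOddCutSlack (n + k) (embedOddSet U) (extendPMatch hM₀ N)) =
      pmOddCutSlack n := by
    funext U N
    exact pmOddCutSlack_extend hM₀ U N
  rwa [hfun] at h1

/-- **`rk₊(S_n) ≤ rk₊(S_{n+k})` for even `k`** (the same submatrix, nonnegative factorizations).
[cite: Rothvoss2017, §2 footnote (PDF p. 6)] -/
theorem hasNonnegFactorization_pmOddCutSlack_of_add (hk : Even k) {r : ℕ}
    (h : HasNonnegFactorization (pmOddCutSlack (n + k)) r) :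
    HasNonnegFactorization (pmOddCutSlack n) r := by
  obtain ⟨M₀, hM₀⟩ := exists_isPMOn_newBlock (n := n) hk
  have h1 := hasNonnegFactorization_submatrix h (embedOddSet (k := k)) (extendPMatch hM₀)
  have hfun : (fun U N => pmOddCutSlack (n + k) (embedOddSet U) (extendPMatch hM₀ N)) =
      pmOddCutSlack n := by
    funext U N
    exact pmOddCutSlack_extend hM₀ U N
  rwa [hfun] at h1

end Slack

/-- **Psd rank of the odd-cut slack matrix is monotone in even `n`**: `rk_psd(S_n) ≤ rk_psd(S_{n'})`
for `n ≤ n'` both even. [cite: Rothvoss2017, §2 footnote (PDF p. 6)] [cite: FawziEtAl2015, Ex. 5.1 (p14, submatrix step)] -/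
theorem hasPsdFactorization_pmOddCutSlack_mono {n n' r : ℕ} (hle : n ≤ n') (hn : Even n)
    (hn' : Even n') (h : HasPsdFactorization (pmOddCutSlack n') r) :
    HasPsdFactorization (pmOddCutSlack n) r := by
  obtain ⟨k, rfl⟩ := Nat.exists_eq_add_of_le hle
  exact hasPsdFactorization_pmOddCutSlack_of_add ((Nat.even_add.1 hn').1 hn) h

/-- **Nonnegative rank of the odd-cut slack matrix is monotone in even `n`.**
[cite: Rothvoss2017, §2 footnote (PDF p. 6)] -/
theorem hasNonnegFactorization_pmOddCutSlack_mono {n n' r : ℕ} (hle : n ≤ n') (hn : Even n)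
    (hn' : Even n') (h : HasNonnegFactorization (pmOddCutSlack n') r) :
    HasNonnegFactorization (pmOddCutSlack n) r := by
  obtain ⟨k, rfl⟩ := Nat.exists_eq_add_of_le hle
  exact hasNonnegFactorization_pmOddCutSlack_of_add ((Nat.even_add.1 hn').1 hn) h

/-- **Lower bounds on `rk_psd(S_n)` propagate to all larger even `n'`.**
[cite: Rothvoss2017, §2 footnote (PDF p. 6: "thus the lower bound … indeed holds for every even n")] -/
theorem pmOddCutSlack_psdRankLowerBound_mono {n n' K : ℕ} (hle : n ≤ n') (hn : Even n)
    (hn' : Even n')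
    (hK : ∀ r : ℕ, HasPsdFactorization (pmOddCutSlack n) r → K ≤ r) :
    ∀ r : ℕ, HasPsdFactorization (pmOddCutSlack n') r → K ≤ r :=
  fun r hr => hK r (hasPsdFactorization_pmOddCutSlack_mono hle hn hn' hr)

/-! ### The certified small cases propagate: e.g. `rk_psd(S_n) ≥ 35` for every even `n ≥ 16` -/

/-- `rk_psd(S_n) ≥ 9` for every even `n ≥ 8` (from the certified `n = 8`,
`PsdRankSmall.nine_le_of_hasPsdFactorization_eight`). [cite: Rothvoss2017, §2 footnote (PDF p. 6)] [cite: FawziEtAl2015, Thm. 2.10 + Ex. 2.11 (p07)] -/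
theorem nine_le_of_hasPsdFactorization_of_eight_le {n r : ℕ} (h8 : 8 ≤ n) (hn : Even n)
    (h : HasPsdFactorization (pmOddCutSlack n) r) : 9 ≤ r :=
  pmOddCutSlack_psdRankLowerBound_mono h8 (by decide) hn
    (fun _ hr => PsdRankSmall.nine_le_of_hasPsdFactorization_eight hr) r h

/-- `rk_psd(S_n) ≥ 14` for every even `n ≥ 10` (from the certified `n = 10`).
[cite: Rothvoss2017, §2 footnote (PDF p. 6)] [cite: FawziEtAl2015, Thm. 2.10 + Ex. 2.11 (p07)] -/
theorem fourteen_le_of_hasPsdFactorization_of_ten_le {n r : ℕ} (h10 : 10 ≤ n) (hn : Even n)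
    (h : HasPsdFactorization (pmOddCutSlack n) r) : 14 ≤ r :=
  pmOddCutSlack_psdRankLowerBound_mono h10 (by decide) hn
    (fun _ hr => PsdRankSmall.fourteen_le_of_hasPsdFactorization_ten hr) r h

/-- `rk_psd(S_n) ≥ 20` for every even `n ≥ 12` (from the certified `n = 12`).
[cite: Rothvoss2017, §2 footnote (PDF p. 6)] [cite: FawziEtAl2015, Thm. 2.10 + Ex. 2.11 (p07)] -/
theorem twenty_le_of_hasPsdFactorization_of_twelve_le {n r : ℕ} (h12 : 12 ≤ n) (hn : Even n)
    (h : HasPsdFactorization (pmOddCutSlack n) r) : 20 ≤ r :=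
  pmOddCutSlack_psdRankLowerBound_mono h12 (by decide) hn
    (fun _ hr => PsdRankSmall.twenty_le_of_hasPsdFactorization_twelve hr) r h

/-- `rk_psd(S_n) ≥ 27` for every even `n ≥ 14` (from the certified `n = 14`).
[cite: Rothvoss2017, §2 footnote (PDF p. 6)] [cite: FawziEtAl2015, Thm. 2.10 + Ex. 2.11 (p07)] -/
theorem twentyseven_le_of_hasPsdFactorization_of_fourteen_le {n r : ℕ} (h14 : 14 ≤ n)
    (hn : Even n)
    (h : HasPsdFactorization (pmOddCutSlack n) r) : 27 ≤ r :=
  pmOddCutSlack_psdRankLowerBound_mono h14 (by decide) hn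
    (fun _ hr => PsdRankSmall.twentyseven_le_of_hasPsdFactorization_fourteen hr) r h

/-- **`rk_psd(S_n) ≥ 35` for every even `n ≥ 16`** (from the certified `n = 16`,
`PsdRankSmall.thirtyfive_le_of_hasPsdFactorization_sixteen`; this beats the general triangular-pattern bound
`C(n/2 − 1, 2)` of `choose_two_le_of_hasPsdFactorization` for `n = 18`).
[cite: Rothvoss2017, §2 footnote (PDF p. 6)] [cite: FawziEtAl2015, Thm. 2.10 + Ex. 2.11 (p07)] -/
theorem thirtyfive_le_of_hasPsdFactorization_of_sixteen_le {n r : ℕ} (h16 : 16 ≤ n)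
    (hn : Even n)
    (h : HasPsdFactorization (pmOddCutSlack n) r) : 35 ≤ r :=
  pmOddCutSlack_psdRankLowerBound_mono h16 (by decide) hn
    (fun _ hr => PsdRankSmall.thirtyfive_le_of_hasPsdFactorization_sixteen hr) r h

/-! ### Block lifts: `(S^b_+)^m`-lifts of `P_PM(K_{n'})` restrict to `P_PM(K_n)`, `n ≤ n'` even -/

section Block

variable {M₀ : Finset (Sym2 (Fin (n + k)))}

/-- The face `F_{M₀}` as the section of `P_PM(K_{n+k})` by an affine subspace (the hyperplane
`Σ_{e ∈ M₀} x_e = |M₀|`, as the comap of a point). [cite: Rothvoss2017, §2 footnote (PDF p. 6)] -/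
theorem pmFace_eq_inter_affineSubspace (M₀ : Finset (Sym2 (Fin (n + k)))) :
    pmFace M₀ = pmPolytope (n + k) ∩
      ((affineSpan ℝ {((pmEdgeSet M₀).card : ℝ)}).comap (pmEdgeMass M₀).toAffineMap :
        AffineSubspace ℝ (EKn (n + k) → ℝ)) := by
  unfold pmFace
  congr 1
  ext x
  rw [AffineSubspace.coe_comap, AffineSubspace.coe_affineSpan_singleton, Set.mem_preimage,
    Set.mem_singleton_iff, LinearMap.coe_toAffineMap, Set.mem_setOf_eq]

/-- **`(S^b_+)^m`-lifts of `P_PM(K_{n+k})` restrict to `P_PM(K_n)`** for even `k` (faces are affine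
sections — `HasBlockPsdLift.inter_affineSubspace` — and projections are free —
`HasBlockPsdLift.image`; the face is `image_pmFace`). Factorization-side counterpart in the tree:
`HasBlockPsdFactorization.of_le`. [cite: Rothvoss2017, §2 footnote (PDF p. 6)] [cite: FawziParrilo2013, §1.2 (p. 4)] -/
theorem hasBlockPsdLift_pmPolytope_of_add (hk : Even k) {b m : ℕ}
    (h : HasBlockPsdLift (pmPolytope (n + k)) b m) : HasBlockPsdLift (pmPolytope n) b m := by
  classical
  obtain ⟨M₀, hM₀⟩ := exists_isPMOn_newBlock (n := n) hk
  have h1 : HasBlockPsdLift (pmFace M₀) b m := by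
    rw [pmFace_eq_inter_affineSubspace]
    exact h.inter_affineSubspace _
  have h2 := h1.image (restrictOld n k)
  rwa [image_pmFace hM₀] at h2

end Block

/-- **`(S^b_+)^m`-lifts of `P_PM(K_{n'})` restrict to `P_PM(K_n)` for `n ≤ n'` both even** (LP lifts
`b = 1`, second-order-cone lifts `b = 2`, psd lifts `m = 1`).
[cite: Rothvoss2017, §2 footnote (PDF p. 6)] [cite: FawziParrilo2013, §1.2 (p. 4)] -/
theorem hasBlockPsdLift_pmPolytope_mono {n n' b m : ℕ} (hle : n ≤ n') (hn : Even n)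
    (hn' : Even n') (h : HasBlockPsdLift (pmPolytope n') b m) : HasBlockPsdLift (pmPolytope n) b m := by
  obtain ⟨k, rfl⟩ := Nat.exists_eq_add_of_le hle
  exact hasBlockPsdLift_pmPolytope_of_add ((Nat.even_add.1 hn').1 hn) h

/-- Lower bounds on the number of blocks propagate upward in even `n`.
[cite: Rothvoss2017, §2 footnote (PDF p. 6)] -/
theorem pmPolytope_blockLowerBound_mono {n n' b : ℕ} (hle : n ≤ n') (hn : Even n)
    (hn' : Even n') {B : ℝ} (hB : ∀ m : ℕ, HasBlockPsdLift (pmPolytope n) b m → B ≤ m) :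
    ∀ m : ℕ, HasBlockPsdLift (pmPolytope n') b m → B ≤ m :=
  fun m hm => hB m (hasBlockPsdLift_pmPolytope_mono hle hn hn' hm)

end Literature.Barriers.PneNP

end
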